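import Literature.Geometry.Riemannian.ThreeShrinkerDegenerateCovering
import HarnessLib

/-!
# Degenerate three-dimensional shrinkers: the model isometries of the cylinder

Continuation of `ThreeShrinkerDegenerateCovering` (degenerate case of Munteanu–Wang 2016, Thm. 1.2).
The deck transformations of the developing map `Φ : C → M` will be shown to be among the
**model isometries** of the conformal cylinder `C = (ℝ³ ∖ 0, g_c = 2|y|⁻²δ)`:

* `scaleLin c Q : y ↦ c Q y` and `scaleInv c Q : y ↦ c Q y / |y|²`, `c > 0`, `Q ∈ O(3)`
  (in cylinder coordinates `(ŷ, log|y|) ∈ S² × ℝ`: `(q, t) ↦ (Qq, t + log c)` and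
  `(q, t) ↦ (Qq, log c − t)`).

We prove that they are smooth isometries of `g_c` with the displayed differentials
(`mfderiv_scaleLin_apply`, `mfderiv_scaleInv_apply`, `cyl3_scaleLin`, `cyl3_scaleInv`), the four
composition laws, and that `f_C`-invariance forces `c = 1`. The Householder reflection `Hh a`
(`u ↦ u − 2⟨a,u⟩a/|a|²`) is the differential correction of the inversion.

Everything is proved; the only new `def`s are explicit maps (no named facts, D-0026).

## References

* O. Munteanu, J. Wang, arXiv:1606.01861, Thm. 1.2 (p. 3). [MunteanuWang2016]
* B. O'Neill, *Semi-Riemannian Geometry*, Academic Press 1983, Ch. 3, Prop. 3.62; Ch. 7, Cor. 29.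
  [ONeill1983]
-/

noncomputable section

open Bundle Set Function Filter Module Metric
open scoped Manifold ContDiff Topology NNReal RealInnerProductSpace

namespace Literature.Geometry.Riemannian

open Lorentzian Lorentzian.PseudoRiemannianMetric RoundCylinderThree

/-! ### Self-maps of an open subset of a vector space -/

namespace OpensSelfMap

variable {E : Type*} [NormedAddCommGroup E] [NormedSpace ℝ E] {U : TopologicalSpace.Opens E}

/-- **Smoothness of a self-map of an open set given by a smooth ambient map.** [folklore] -/
theorem contMDiffAt {F : U → U} {Ψ : E → E} (h : ∀ y : U, ((F y : U) : E) = Ψ y) {y : U}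
    (hΨ : ContDiffAt ℝ ∞ Ψ y) : ContMDiffAt 𝓘(ℝ, E) 𝓘(ℝ, E) ∞ F y := by
  rw [← ContMDiffAt.subtypeVal_comp_iff U F y]
  exact (OpensChart.contMDiffAt_iff y (Subtype.val ∘ F) Ψ h).2 hΨ

/-- **The differential of a self-map of an open set given by a differentiable ambient map** is the
ambient Fréchet derivative. [folklore] -/
theorem mfderiv_apply {F : U → U} {Ψ : E → E} (h : ∀ y : U, ((F y : U) : E) = Ψ y) {y : U}
    (hΨ : ContDiffAt ℝ ∞ Ψ y) (v : E) :
    (mfderiv 𝓘(ℝ, E) 𝓘(ℝ, E) F y v : E) = fderiv ℝ Ψ y v := by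
  have hF : MDifferentiableAt 𝓘(ℝ, E) 𝓘(ℝ, E) F y :=
    (contMDiffAt h hΨ).mdifferentiableAt (by simp)
  have h1 : mfderiv 𝓘(ℝ, E) 𝓘(ℝ, E) (fun y' : U ↦ Ψ y') y v = fderiv ℝ Ψ y v := by
    rw [OpensChart.mfderiv_eq y _ Ψ (fun _ ↦ rfl) (hΨ.differentiableAt (by simp))]
    rfl
  have hcomp : (fun y' : U ↦ Ψ y') = (extChartAt 𝓘(ℝ, E) (F y)) ∘ F := by
    funext y'
    rw [Function.comp_apply, OpensChart.extChartAt_coe]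
    exact (h y').symm
  have hc : MDifferentiableAt 𝓘(ℝ, E) 𝓘(ℝ, E) (extChartAt 𝓘(ℝ, E) (F y)) (F y) :=
    mdifferentiableAt_extChartAt (mem_chart_source E (F y))
  rw [hcomp, mfderiv_comp y hc hF] at h1
  rw [← h1]
  exact (OpensChart.mfderiv_extChartAt_apply (F y) _).symm

end OpensSelfMap

namespace RoundCylinderThree

/-! ### Orthogonal maps and the Householder reflection -/

/-- `Q` preserves the inner product of `ℝ³`. [folklore] -/
def IsOrtho (Q : E3 →L[ℝ] E3) : Prop := ∀ u w : E3, ⟪Q u, Q w⟫ = ⟪u, w⟫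

namespace IsOrtho

variable {Q Q' : E3 →L[ℝ] E3}

/-- An orthogonal map preserves norms. [folklore] -/
theorem norm_eq (hQ : IsOrtho Q) (u : E3) : ‖Q u‖ = ‖u‖ := by
  have h := hQ u u
  rw [real_inner_self_eq_norm_sq, real_inner_self_eq_norm_sq] at h
  nlinarith [norm_nonneg (Q u), norm_nonneg u, h]

/-- An orthogonal map has trivial kernel (pointwise form). [folklore] -/
theorem ne_zero (hQ : IsOrtho Q) {u : E3} (hu : u ≠ 0) : Q u ≠ 0 := by
  intro h
  have := hQ.norm_eq u
  rw [h, norm_zero] at this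
  exact hu (norm_eq_zero.1 this.symm)

/-- An orthogonal map is injective. [folklore] -/
theorem injective (hQ : IsOrtho Q) : Injective Q := by
  intro u w h
  have h0 : Q (u - w) = 0 := by rw [map_sub, h, sub_self]
  by_contra hne
  exact hQ.ne_zero (sub_ne_zero.2 hne) h0

/-- Orthogonal maps are closed under composition. [folklore] -/
theorem comp (hQ : IsOrtho Q) (hQ' : IsOrtho Q') : IsOrtho (Q.comp Q') := fun u w ↦ by
  rw [ContinuousLinearMap.comp_apply, ContinuousLinearMap.comp_apply, hQ, hQ']

/-- `−Q` is orthogonal when `Q` is. [folklore] -/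
theorem neg (hQ : IsOrtho Q) : IsOrtho (-Q) := fun u w ↦ by
  rw [neg_apply, neg_apply, inner_neg_neg, hQ]

/-- The identity is orthogonal. [folklore] -/
theorem id : IsOrtho (ContinuousLinearMap.id ℝ E3) := fun _ _ ↦ rfl

end IsOrtho

/-- **The Householder reflection** across `a^⊥`: `u ↦ u − (2⟨a,u⟩/|a|²) a`. [folklore] -/
def Hh (a : E3) : E3 →L[ℝ] E3 :=
  ContinuousLinearMap.id ℝ E3 - (2 / ‖a‖ ^ 2) • (innerSL ℝ a).smulRight a

/-- Formula for the Householder reflection. [folklore] -/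
theorem Hh_apply (a u : E3) : Hh a u = u - (2 / ‖a‖ ^ 2 * ⟪a, u⟫) • a := by
  simp only [Hh, sub_apply, ContinuousLinearMap.id_apply,
    smul_apply, ContinuousLinearMap.smulRight_apply, innerSL_apply_apply, smul_smul]

/-- `H_a a = −a`. [folklore] -/
theorem Hh_self {a : E3} (ha : a ≠ 0) : Hh a a = -a := by
  have hn : ‖a‖ ^ 2 ≠ 0 := pow_ne_zero 2 (norm_ne_zero_iff.2 ha)
  rw [Hh_apply, real_inner_self_eq_norm_sq, div_mul_cancel₀ _ hn, two_smul]
  abel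

/-- `H_a` fixes `a^⊥`. [folklore] -/
theorem Hh_of_inner_eq_zero {a u : E3} (h : ⟪a, u⟫ = 0) : Hh a u = u := by
  rw [Hh_apply, h, mul_zero, zero_smul, sub_zero]

/-- The Householder reflection is orthogonal. [folklore] -/
theorem isOrtho_Hh {a : E3} (ha : a ≠ 0) : IsOrtho (Hh a) := by
  intro u w
  have hn : ‖a‖ ^ 2 ≠ 0 := pow_ne_zero 2 (norm_ne_zero_iff.2 ha)
  rw [Hh_apply, Hh_apply, inner_sub_left, inner_sub_right, inner_sub_right, real_inner_smul_left,
    real_inner_smul_left, real_inner_smul_right, real_inner_smul_right, real_inner_self_eq_norm_sq,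
    real_inner_comm u a, real_inner_comm w a]
  field_simp
  ring

/-- `Hh a ∘ Hh a = id`. [folklore] -/
theorem Hh_Hh {a : E3} (ha : a ≠ 0) (u : E3) : Hh a (Hh a u) = u := by
  have hn : ‖a‖ ^ 2 ≠ 0 := pow_ne_zero 2 (norm_ne_zero_iff.2 ha)
  rw [Hh_apply, Hh_apply, inner_sub_right, real_inner_smul_right, real_inner_self_eq_norm_sq]
  have : 2 / ‖a‖ ^ 2 * (⟪a, u⟫ - 2 / ‖a‖ ^ 2 * ⟪a, u⟫ * ‖a‖ ^ 2) = -(2 / ‖a‖ ^ 2 * ⟪a, u⟫) := by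
    field_simp; ring
  rw [this, neg_smul, sub_neg_eq_add, sub_add_cancel]

/-! ### The model maps -/

open Classical in
/-- **`y ↦ c Q y`** on `ℝ³ ∖ 0` (junk `y` when `c Q y = 0`). [folklore] -/
def scaleLin (c : ℝ) (Q : E3 →L[ℝ] E3) : P3 → P3 := fun y ↦
  if h : c • Q (y : E3) ∈ (punctured : Set E3) then ⟨c • Q (y : E3), h⟩ else y

open Classical in
/-- **`y ↦ c Q y / |y|²`** on `ℝ³ ∖ 0` (junk `y` when the value vanishes). [folklore] -/
def scaleInv (c : ℝ) (Q : E3 →L[ℝ] E3) : P3 → P3 := fun y ↦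
  if h : (c * (‖(y : E3)‖ ^ 2)⁻¹) • Q (y : E3) ∈ (punctured : Set E3) then
    ⟨(c * (‖(y : E3)‖ ^ 2)⁻¹) • Q (y : E3), h⟩ else y

/-- The ambient formula of `scaleLin`. [folklore] -/
def linE (c : ℝ) (Q : E3 →L[ℝ] E3) : E3 → E3 := fun z ↦ c • Q z

/-- The ambient formula of `scaleInv`. [folklore] -/
def invE (c : ℝ) (Q : E3 →L[ℝ] E3) : E3 → E3 := fun z ↦ (c * (‖z‖ ^ 2)⁻¹) • Q z

/-- Membership in `ℝ³ ∖ 0`. [folklore] -/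
theorem mem_punctured_iff {z : E3} : z ∈ (punctured : Set E3) ↔ z ≠ 0 := Iff.rfl

variable {c : ℝ} {Q : E3 →L[ℝ] E3}

/-- `c Q y ≠ 0` for `y ≠ 0`. [folklore] -/
theorem linE_ne_zero (hc : 0 < c) (hQ : IsOrtho Q) (y : P3) : linE c Q y ≠ 0 := by
  rw [linE]
  exact smul_ne_zero hc.ne' (hQ.ne_zero (coe_ne_zero y))

/-- `c Q y/|y|² ≠ 0` for `y ≠ 0`. [folklore] -/
theorem invE_ne_zero (hc : 0 < c) (hQ : IsOrtho Q) (y : P3) : invE c Q y ≠ 0 := by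
  rw [invE]
  refine smul_ne_zero (mul_ne_zero hc.ne' (inv_ne_zero ?_)) (hQ.ne_zero (coe_ne_zero y))
  exact pow_ne_zero 2 (norm_pos y).ne'

/-- The ambient value of `scaleLin`. [folklore] -/
theorem coe_scaleLin (hc : 0 < c) (hQ : IsOrtho Q) (y : P3) :
    ((scaleLin c Q y : P3) : E3) = linE c Q y := by
  have h : c • Q (y : E3) ∈ (punctured : Set E3) := linE_ne_zero hc hQ y
  simp only [scaleLin, h, dif_pos]
  rfl

/-- The ambient value of `scaleInv`. [folklore] -/
theorem coe_scaleInv (hc : 0 < c) (hQ : IsOrtho Q) (y : P3) :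
    ((scaleInv c Q y : P3) : E3) = invE c Q y := by
  have h : (c * (‖(y : E3)‖ ^ 2)⁻¹) • Q (y : E3) ∈ (punctured : Set E3) := invE_ne_zero hc hQ y
  simp only [scaleInv, h, dif_pos]
  rfl

/-- `|c Q z| = c|z|`. [folklore] -/
theorem norm_linE (hQ : IsOrtho Q) (hc : 0 < c) (z : E3) : ‖linE c Q z‖ = c * ‖z‖ := by
  rw [linE, norm_smul, Real.norm_eq_abs, abs_of_pos hc, hQ.norm_eq]

/-- `|c Q z/|z|²| = c/|z|`. [folklore] -/
theorem norm_invE (hQ : IsOrtho Q) (hc : 0 < c) {z : E3} (hz : z ≠ 0) : ‖invE c Q z‖ = c / ‖z‖ := by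
  have hn : 0 < ‖z‖ := norm_pos_iff.2 hz
  rw [invE, norm_smul, Real.norm_eq_abs, abs_of_pos (mul_pos hc (inv_pos.2 (pow_pos hn 2))),
    hQ.norm_eq]
  field_simp

/-! ### Smoothness and differentials -/

/-- `z ↦ c Q z` is smooth. [folklore] -/
theorem contDiff_linE {n : WithTop ℕ∞} : ContDiff ℝ n (linE c Q) :=
  Q.contDiff.const_smul c

/-- `d(c Q ·) = c Q`. [folklore] -/
theorem hasFDerivAt_linE (z : E3) : HasFDerivAt (linE c Q) (c • Q) z := by
  have h := (Q.hasFDerivAt (x := z)).const_smul c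
  exact h

/-- `d(|z|⁻²) = −2|z|⁻⁴⟨z, ·⟩`. [folklore] -/
theorem hasFDerivAt_inv_norm_sq {z : E3} (hz : z ≠ 0) :
    HasFDerivAt (fun w : E3 ↦ (‖w‖ ^ 2)⁻¹) ((-2 * ((‖z‖ ^ 2) ^ 2)⁻¹) • innerSL ℝ z) z := by
  have hn2 : ‖z‖ ^ 2 ≠ 0 := pow_ne_zero 2 (norm_ne_zero_iff.2 hz)
  have h1 : HasFDerivAt (fun w : E3 ↦ ‖w‖ ^ 2) (2 • innerSL ℝ z) z :=
    (hasStrictFDerivAt_norm_sq z).hasFDerivAt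
  have h := (hasDerivAt_inv hn2).comp_hasFDerivAt z h1
  refine h.congr_fderiv (ContinuousLinearMap.ext fun v ↦ ?_)
  simp only [smul_apply, innerSL_apply_apply, smul_eq_mul, nsmul_eq_mul, Nat.cast_ofNat]
  ring

/-- `z ↦ c Q z/|z|²` is smooth off `0`. [folklore] -/
theorem contDiffAt_invE {z : E3} (hz : z ≠ 0) {n : WithTop ℕ∞} : ContDiffAt ℝ n (invE c Q) z := by
  have h1 : ContDiffAt ℝ n (fun w : E3 ↦ ‖w‖ ^ 2) z := (contDiffAt_id.norm_sq ℝ)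
  have h2 : ContDiffAt ℝ n (fun w : E3 ↦ (‖w‖ ^ 2)⁻¹) z :=
    h1.inv (pow_ne_zero 2 (norm_ne_zero_iff.2 hz))
  exact (contDiffAt_const.mul h2).smul Q.contDiff.contDiffAt

/-- `d(invE)_z v = (c/|z|²) Q (Hh z v)`. [folklore] -/
theorem hasFDerivAt_invE {z : E3} (hz : z ≠ 0) :
    HasFDerivAt (invE c Q) ((c * (‖z‖ ^ 2)⁻¹) • (Q.comp (Hh z))) z := by
  have hn : ‖z‖ ≠ 0 := norm_ne_zero_iff.2 hz
  have hn2 : ‖z‖ ^ 2 ≠ 0 := pow_ne_zero 2 hn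
  have hρ := (hasFDerivAt_inv_norm_sq hz).const_mul c
  have h := hρ.smul (Q.hasFDerivAt (x := z))
  refine h.congr_fderiv (ContinuousLinearMap.ext fun v ↦ ?_)
  simp only [add_apply, smul_apply, ContinuousLinearMap.smulRight_apply,
    ContinuousLinearMap.comp_apply, Hh_apply, map_sub, map_smul, innerSL_apply_apply, smul_eq_mul]
  module

/-- `d(c Q ·/|·|²)_z v = (c/|z|²) Q (H_z v)`. [folklore] -/
theorem fderiv_invE_apply {z : E3} (hz : z ≠ 0) (v : E3) :
    fderiv ℝ (invE c Q) z v = (c * (‖z‖ ^ 2)⁻¹) • Q (Hh z v) := by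
  rw [(hasFDerivAt_invE hz).fderiv]
  rfl

/-- **`scaleLin` is smooth.** [folklore] -/
theorem contMDiff_scaleLin (hc : 0 < c) (hQ : IsOrtho Q) :
    ContMDiff 𝓘(ℝ, E3) 𝓘(ℝ, E3) ∞ (scaleLin c Q) := fun _ ↦
  OpensSelfMap.contMDiffAt (coe_scaleLin hc hQ) contDiff_linE.contDiffAt

/-- **`scaleInv` is smooth.** [folklore] -/
theorem contMDiff_scaleInv (hc : 0 < c) (hQ : IsOrtho Q) :
    ContMDiff 𝓘(ℝ, E3) 𝓘(ℝ, E3) ∞ (scaleInv c Q) := fun y ↦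
  OpensSelfMap.contMDiffAt (coe_scaleInv hc hQ) (contDiffAt_invE (coe_ne_zero y))

/-- **`d(scaleLin)_y v = c Q v`.** [folklore] -/
theorem mfderiv_scaleLin_apply (hc : 0 < c) (hQ : IsOrtho Q) (y : P3) (v : E3) :
    (mfderiv 𝓘(ℝ, E3) 𝓘(ℝ, E3) (scaleLin c Q) y v : E3) = c • Q v := by
  rw [OpensSelfMap.mfderiv_apply (coe_scaleLin hc hQ) contDiff_linE.contDiffAt,
    (hasFDerivAt_linE (c := c) (Q := Q) (y : E3)).fderiv]
  rfl

/-- **`d(scaleInv)_y v = (c/|y|²) Q (Hh y v)`.** [folklore] -/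
theorem mfderiv_scaleInv_apply (hc : 0 < c) (hQ : IsOrtho Q) (y : P3) (v : E3) :
    (mfderiv 𝓘(ℝ, E3) 𝓘(ℝ, E3) (scaleInv c Q) y v : E3) =
      (c * (‖(y : E3)‖ ^ 2)⁻¹) • Q (Hh (y : E3) v) := by
  rw [OpensSelfMap.mfderiv_apply (coe_scaleInv hc hQ) (contDiffAt_invE (coe_ne_zero y)),
    fderiv_invE_apply (coe_ne_zero y)]

/-! ### Isometry -/

/-- **`scaleLin c Q` is an isometry of `g_c`.** [folklore] -/
theorem cyl3_scaleLin (hc : 0 < c) (hQ : IsOrtho Q) (y : P3) (u w : E3) :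
    cyl3.val (scaleLin c Q y) (mfderiv 𝓘(ℝ, E3) 𝓘(ℝ, E3) (scaleLin c Q) y u)
      (mfderiv 𝓘(ℝ, E3) 𝓘(ℝ, E3) (scaleLin c Q) y w) = cyl3.val y u w := by
  rw [cyl3_apply, cyl3_apply, mfderiv_scaleLin_apply hc hQ, mfderiv_scaleLin_apply hc hQ,
    coe_scaleLin hc hQ, norm_linE hQ hc, real_inner_smul_left, real_inner_smul_right, hQ]
  have hn : ‖(y : E3)‖ ≠ 0 := (norm_pos y).ne'
  field_simp

/-- **`scaleInv c Q` is an isometry of `g_c`.** [folklore] -/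
theorem cyl3_scaleInv (hc : 0 < c) (hQ : IsOrtho Q) (y : P3) (u w : E3) :
    cyl3.val (scaleInv c Q y) (mfderiv 𝓘(ℝ, E3) 𝓘(ℝ, E3) (scaleInv c Q) y u)
      (mfderiv 𝓘(ℝ, E3) 𝓘(ℝ, E3) (scaleInv c Q) y w) = cyl3.val y u w := by
  rw [cyl3_apply, cyl3_apply, mfderiv_scaleInv_apply hc hQ, mfderiv_scaleInv_apply hc hQ,
    coe_scaleInv hc hQ, norm_invE hQ hc (coe_ne_zero y), real_inner_smul_left, real_inner_smul_right,
    hQ, isOrtho_Hh (coe_ne_zero y)]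
  have hn : ‖(y : E3)‖ ≠ 0 := (norm_pos y).ne'
  field_simp

/-! ### Composition laws -/

/-- `(cQ) ∘ (c'Q') = (cc') QQ'`. [folklore] -/
theorem scaleLin_scaleLin (hc : 0 < c) (hQ : IsOrtho Q) {c' : ℝ} {Q' : E3 →L[ℝ] E3} (hc' : 0 < c')
    (hQ' : IsOrtho Q') :
    scaleLin c Q ∘ scaleLin c' Q' = scaleLin (c * c') (Q.comp Q') := by
  funext y
  apply Subtype.ext
  rw [Function.comp_apply, coe_scaleLin hc hQ, coe_scaleLin (mul_pos hc hc') (hQ.comp hQ'), linE,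
    coe_scaleLin hc' hQ', linE, linE, map_smul, smul_smul, ContinuousLinearMap.comp_apply, mul_comm]

/-- `(cQ) ∘ (c'Q'/|·|²) = (cc') QQ'/|·|²`. [folklore] -/
theorem scaleLin_scaleInv (hc : 0 < c) (hQ : IsOrtho Q) {c' : ℝ} {Q' : E3 →L[ℝ] E3} (hc' : 0 < c')
    (hQ' : IsOrtho Q') :
    scaleLin c Q ∘ scaleInv c' Q' = scaleInv (c * c') (Q.comp Q') := by
  funext y
  apply Subtype.ext
  rw [Function.comp_apply, coe_scaleLin hc hQ, coe_scaleInv (mul_pos hc hc') (hQ.comp hQ'), linE,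
    coe_scaleInv hc' hQ', invE, invE, map_smul, smul_smul, ContinuousLinearMap.comp_apply]
  congr 1
  ring

/-- `(cQ/|·|²) ∘ (c'Q') = (c/c') QQ'/|·|²`. [folklore] -/
theorem scaleInv_scaleLin (hc : 0 < c) (hQ : IsOrtho Q) {c' : ℝ} {Q' : E3 →L[ℝ] E3} (hc' : 0 < c')
    (hQ' : IsOrtho Q') :
    scaleInv c Q ∘ scaleLin c' Q' = scaleInv (c / c') (Q.comp Q') := by
  funext y
  apply Subtype.ext
  have hn : ‖(y : E3)‖ ≠ 0 := (norm_pos y).ne'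
  rw [Function.comp_apply, coe_scaleInv hc hQ, coe_scaleInv (div_pos hc hc') (hQ.comp hQ'), invE,
    coe_scaleLin hc' hQ', norm_linE hQ' hc', linE, invE, map_smul, smul_smul,
    ContinuousLinearMap.comp_apply]
  congr 1
  field_simp

/-- `(cQ/|·|²) ∘ (c'Q'/|·|²) = (c/c') QQ'`. [folklore] -/
theorem scaleInv_scaleInv (hc : 0 < c) (hQ : IsOrtho Q) {c' : ℝ} {Q' : E3 →L[ℝ] E3} (hc' : 0 < c')
    (hQ' : IsOrtho Q') :
    scaleInv c Q ∘ scaleInv c' Q' = scaleLin (c / c') (Q.comp Q') := by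
  funext y
  apply Subtype.ext
  have hn : ‖(y : E3)‖ ≠ 0 := (norm_pos y).ne'
  rw [Function.comp_apply, coe_scaleInv hc hQ, coe_scaleLin (div_pos hc hc') (hQ.comp hQ'), invE,
    coe_scaleInv hc' hQ', norm_invE hQ' hc' (coe_ne_zero y), invE, linE, map_smul, smul_smul,
    ContinuousLinearMap.comp_apply]
  congr 1
  field_simp

/-- `scaleLin 1 id = id`. [folklore] -/
theorem scaleLin_one_id : scaleLin 1 (ContinuousLinearMap.id ℝ E3) = _root_.id := by
  funext y
  apply Subtype.ext
  rw [coe_scaleLin one_pos IsOrtho.id, linE, one_smul]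
  rfl

/-! ### `f_C`-invariance forces `c = 1` -/

/-- `f_C(y) = 1 ↔ |y| = 1`. [folklore] -/
theorem fP_eq_one_iff_norm (y : P3) : fP y = 1 ↔ ‖(y : E3)‖ = 1 := by
  rw [fP_eq, fE, LE_eq_log (coe_ne_zero y)]
  constructor
  · intro h
    have h2 : Real.log ‖(y : E3)‖ ^ 2 = 0 := by linarith
    have h3 : Real.log ‖(y : E3)‖ = 0 := pow_eq_zero_iff (two_ne_zero) |>.1 h2
    rcases Real.log_eq_zero.1 h3 with h4 | h4 | h4
    · exact absurd h4 (norm_pos y).ne'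
    · exact h4
    · linarith [norm_nonneg (y : E3)]
  · intro h
    rw [h, Real.log_one]
    norm_num

/-- `f_C`-invariance of `y ↦ cQy` at a unit vector forces `c = 1`. [folklore] -/
theorem eq_one_of_fP_scaleLin (hc : 0 < c) (hQ : IsOrtho Q) (o : sphere (0 : E3) 1)
    (h : fP (scaleLin c Q (basePt o)) = fP (basePt o)) : c = 1 := by
  rw [DegenerateShrinker.fP_basePt, fP_eq_one_iff_norm, coe_scaleLin hc hQ, norm_linE hQ hc, coe_basePt,
    norm_eq_of_mem_sphere, mul_one] at h
  exact h

/-- `f_C`-invariance of `y ↦ cQy/|y|²` at a unit vector forces `c = 1`. [folklore] -/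
theorem eq_one_of_fP_scaleInv (hc : 0 < c) (hQ : IsOrtho Q) (o : sphere (0 : E3) 1)
    (h : fP (scaleInv c Q (basePt o)) = fP (basePt o)) : c = 1 := by
  rw [DegenerateShrinker.fP_basePt, fP_eq_one_iff_norm, coe_scaleInv hc hQ,
    norm_invE hQ hc (coe_ne_zero _), coe_basePt, norm_eq_of_mem_sphere, div_one] at h
  exact h

/-! ### Special elements: the antipodal map and the antipodal inversion -/

/-- The antipodal map `α(y) = −y`. [folklore] -/
def antipode : P3 → P3 := scaleLin 1 (-ContinuousLinearMap.id ℝ E3)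

/-- The antipodal inversion `σ₀(y) = −y/|y|²`. [folklore] -/
def antiInv : P3 → P3 := scaleInv 1 (-ContinuousLinearMap.id ℝ E3)

/-- `α(y) = −y`. [folklore] -/
theorem coe_antipode (y : P3) : ((antipode y : P3) : E3) = -(y : E3) := by
  rw [antipode, coe_scaleLin one_pos IsOrtho.id.neg, linE, one_smul]
  rfl

/-- `σ₀(y) = −y/|y|²`. [folklore] -/
theorem coe_antiInv (y : P3) : ((antiInv y : P3) : E3) = -((‖(y : E3)‖ ^ 2)⁻¹ • (y : E3)) := by
  rw [antiInv, coe_scaleInv one_pos IsOrtho.id.neg, invE, one_mul, neg_apply,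
    ContinuousLinearMap.id_apply, smul_neg]

/-- `α` has no fixed point. [folklore] -/
theorem antipode_ne (y : P3) : antipode y ≠ y := by
  intro h
  have h' := congrArg (fun z : P3 ↦ (z : E3)) h
  simp only [coe_antipode] at h'
  have : (y : E3) = 0 := by
    have h2 : (2 : ℝ) • (y : E3) = 0 := by rw [two_smul]; nth_rewrite 1 [← h']; exact neg_add_cancel _
    exact (smul_eq_zero.1 h2).resolve_left two_ne_zero
  exact coe_ne_zero y this

/-- `σ₀` has no fixed point. [folklore] -/
theorem antiInv_ne (y : P3) : antiInv y ≠ y := by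
  intro h
  have h' := congrArg (fun z : P3 ↦ ⟪(z : E3), (y : E3)⟫) h
  simp only [coe_antiInv, inner_neg_left, real_inner_smul_left, real_inner_self_eq_norm_sq] at h'
  have hn : ‖(y : E3)‖ ^ 2 ≠ 0 := pow_ne_zero 2 (norm_pos y).ne'
  rw [inv_mul_cancel₀ hn] at h'
  have : (0 : ℝ) < ‖(y : E3)‖ ^ 2 := pow_pos (norm_pos y) 2
  linarith

/-- `α ∘ σ₀ = (y ↦ y/|y|²)` fixes the unit sphere. [folklore] -/
theorem antipode_antiInv_basePt (o : sphere (0 : E3) 1) : antipode (antiInv (basePt o)) = basePt o := by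
  apply Subtype.ext
  rw [coe_antipode, coe_antiInv, coe_basePt, norm_eq_of_mem_sphere, one_pow, inv_one, one_smul, neg_neg]

end RoundCylinderThree

end Literature.Geometry.Riemannian

end
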